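import Literature.MathematicalPhysics.QuantumFieldTheory.Balaban1983to89.Step
import Literature.MathematicalPhysics.QuantumFieldTheory.Balaban1983to89.B16Sect1Backgrounds
import Literature.MathematicalPhysics.QuantumFieldTheory.Balaban1983to89.B12RTGaugeInvariance254
import Literature.MathematicalPhysics.QuantumFieldTheory.Balaban1983to89.B12Eq18Current

/-!
# `Balaban1983to89.B12GaugeOrbits021` — [Balaban1987RG1] p. 256 «The space of configurations U in (0.21) is invariant
with respect to the gauge transformations u defined on T and satisfying the condition u = 1 on T⁽ᵏ⁾. These
transformations form a group, and the functional (0.21) can be considered on orbits of this group», p. 263 «These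
assumptions imply that the action A_k(U) […] is gauge invariant with respect to all G-valued transformations» and
p. 265 «This does not change the expressions in (2.1) because this gauge transformation is equal to 1 on T⁽ᵏ⁾» — PROVED
(residual gauge group of level `k`, its orbits, the constraint surface `{M^k(U) = V}`, the Wilson functional and the
minimal orbit; the tower-level gauge invariance of the actions (1.3)/(1.6) from (1.19) and the substitution (1.9)/(1.10))

HONEST FRAMING (cell `lit-balaban`, verbatim): statement-level skeleton of published theorems with citation tags;
proofs where landed; nothing here is a claim about the Yang–Mills mass gap.

CITATION HEADER.  T. Bałaban, *Renormalization group approach to lattice gauge field theories. I. Generation of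
effective actions in a small field approximation and a coupling constant renormalization in four dimensions*,
Commun. Math. Phys. **109** (1987) 249–301, doi:10.1007/bf01215223 [Balaban1987RG1] (cell paper B12).  PDF held:
`paper:balaban1987-cmp109-rg-i-small-field` (journal page = PDF page + 248); pp. 254–256 [PDF 6–8], pp. 260–263
[PDF 12–15], p. 265 [PDF 17] re-read this generation from the held text.  Unit `lit-balaban-r09` gen 8 (display owner
of CMP 109; TAKING line `HOME/STATUS.md` 2026-08-21T06:30:24Z), HOME `run/shared/lean/pub/lit-balaban/`; SKELETON rows
`B12.Eq0.21` (the three sentences after (0.21)), `B12.Eq0.22` (*«A_k(g_k, V) = A_k(g_k, U_k(V))»* — independence of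
the representative of the minimal orbit), `B12.Eq1.19` (its last clause *«⇒ A_k … is gauge invariant»*),
`B12.Eq2.2-2.3` (the p. 265 sentence on the axial gauge `Ax_k(T⁽ᵏ⁾, U_{k+1})`).

WHAT IS PRINTED (verbatim; `[…]` inside quotation marks is an omission by the author of this file).
p. 256 [PDF 8]: *«These critical configurations are the minimal configurations investigated in [15], i.e. the minima
of the functional  U → A^η(U),  U : Ū^k = M^k(U) = V on T⁽ᵏ⁾,  (0.21)  where V is a gauge field configuration on the
lattice T⁽ᵏ⁾. The space of configurations U in (0.21) is invariant with respect to the gauge transformations u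
defined on T and satisfying the condition u = 1 on T⁽ᵏ⁾. These transformations form a group, and the functional
(0.21) can be considered on orbits of this group. In [15] it was proved that in a space of regular orbits there exists
exactly one critical orbit, which is a set of minima of the function (0.21). We denote a configuration in this orbit
by U_k(V), or simply by U_k. These configurations are the background fields, and the effective action A_k depends on V
through these fields. We have, as in [16]  A_k(g_k, V) = A_k(g_k, U_k(V)) = −(1/g_k²) A^η(U_k(V)) + 𝐄_k(U_k(V)).
(0.22)»*.  p. 254 [PDF 6]: *«Even with these restrictions the underintegral expression in (0.13) is still invariant
with respect to the gauge transformations u satisfying u(y) = 1 for y ∈ T⁽¹⁾.»*  p. 263 [PDF 15]: *«We assume that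
all functions 𝐄^{(j)}(X, g_{j−1}, 𝐔, 𝐉) are gauge invariant with respect to the group of all gauge transformations
(1.10). Explicitly  𝐄^{(j)}(X, g_{j−1}, 𝐔^u, R(u)𝐉) = 𝐄^{(j)}(X, g_{j−1}, 𝐔, 𝐉)  (1.19)  for all Gᶜ-valued gauge
transformations u. The spaces 𝐔ᶜ_j(X, α₀, α₁) are, by the definition, gauge invariant also. This assumption is an
easily verifiable statement for all explicitly defined terms in the action (1.3). These assumptions imply that the
action A_k(U) defined on the space 𝐔_k(ε₀), which is contained in all the spaces 𝐔ᶜ_j(X, α₀, α₁), is gauge invariant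
with respect to all G-valued transformations.»*  p. 265 [PDF 17]: *«As in Sect. G [15] we write U_k(V′V^{(k)}) =
U′_k(V′)U_{k+1} and we transform at first U′_k(V′) into the axial gauge Ax_k(T⁽ᵏ⁾, U_{k+1}). This does not change the
expressions in (2.1) because this gauge transformation is equal to 1 on T⁽ᵏ⁾.»*

DICTIONARY print → Lean (carriers OF RECORD, nothing re-declared).  «T» = the finest torus `Site P 0` (= `T_η` of
§1) with the coarse lattices `T⁽ᵏ⁾ = Site P k` included in it by the centre embedding iterated,
`B15DeterminingSets.embIter k : Site P k → Site P 0` ([Balaban1987RG1] (0.1) p. 251); gauge transformations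
`GaugeTransf P 0 G = Site P 0 → G` acting by `GaugeField.gaugeAct` (`U^u(b) = u(b₋)U(b)u(b₊)⁻¹`), their restrictions
to the coarse lattices `B16Sect1Backgrounds.toMS u k = u ∘ embIter k`; «Ū^k = M^k(U)» = `Averaging.iter av k U`
(`Setup`), whose gauge covariance IN THE STANDING RANGE `k ≤ m + K` is the tree's `B16Sect1Backgrounds.iter_gaugeAct`
(`M^k(U^u) = (M^k U)^{u∘embIter k}`, from the one-step axiom `Averaging.covariant` = [12] (11)); «A^η» = the `d = 4`
Wilson action `wilsonAction4` (`Setup`, DIVERGENCE F10 of the cell `pub-balaban`); «regular», «minimal configuration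
U_k(V)» = `Setup.IsBackground av reg k V U₀` / `Setup.Background` (B11 Thm 1 = [15] Thm 1 is the QUOTED LEAF asserting
existence and uniqueness of the minimal orbit — NOT claimed here); the actions (1.3)/(1.6) and `𝐄_k` of (0.22)–(0.23)
= `Step.SFTower.action13` / `action16` / `Ek` over the abstract tower `Step.SFTower` (terms `E j X g φ` on an abstract
configuration-pair type `Φ` with an abstract gauge action `act : 𝒢 → Φ → Φ` and the substitution (1.9)
`ofBackground : GaugeField P 0 G → Φ`), the hypothesis (1.19) = the field `Step.SFHyp.gaugeInv119`.
* «u = 1 on T⁽ᵏ⁾» ↦ `IsResidual k u : ∀ y : Site P k, u (embIter k y) = 1` (for `k = 1` this is the one-level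
  `B12FaddeevPopov016.FineGauge` of p. 254, `isResidual_one_iff_fineGauge`); «form a group» ↦ the `Subgroup`
  `residualGroup P G k` of `Site P 0 → G`; «orbits of this group» ↦ the equivalence relation `OrbitRel k` /
  `orbitSetoid P G k` and its classes; «the space of configurations U in (0.21)» ↦ `surface av k V = {U | M^k U = V}`;
  «the functional (0.21) can be considered on orbits» ↦ `wilsonOnOrbits` (`Quotient.lift` of `wilsonAction4`) and,
  on the constraint surface, `functional021OnOrbits`.
* THE SUBSTITUTION (1.9) INTERTWINES (1.10).  The abstract tower does not record how `ofBackground` and `act` are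
  related; the printed reason why (1.19) (invariance in the PAIR variables) gives invariance of `U ↦ 𝐄^{(j)}(X, U, J(U))`
  is the covariance `J(U^u) = R(u)J(U)` of the current (1.8), i.e. `(U^u, J(U^u)) = (U, J(U))^u`.  It enters the
  tower-level theorems as the explicit hypothesis `hι : ∀ u U, T.ofBackground (U^u) = T.act (ι u) (T.ofBackground U)`
  for a map `ι : GaugeTransf P 0 G → 𝒢` (the inclusion of the `G`-valued transformations into the abstract group), and
  it is DISCHARGED (§7) for every tower whose substitution is the concrete one of `B12Eq18Current` (unit p07 gen 3:
  `ofBackground π ξ 𝐔 = (𝐔, J(𝐔))`, `ofBackground_gaugeU`) read through any group homomorphism `ρ : G →* 𝔸ˣ` into the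
  units of the matrix algebra (`intertwines_of_model`).

WHAT IS PROVED (kernel-checked, no `sorry`, standard axioms; definitions with bodies: `IsResidual`, `residualGroup`,
`OrbitRel`, `orbitSetoid`, `surface`, `wilsonOnOrbits`, `surfaceSetoid`, `functional021OnOrbits`, `modelTower`;
everything else theorems).
* §1 `IsResidual`, `isResidual_zero_iff` (level 0: only `u = 1`), `IsResidual.succ`/`.mono` (the groups increase with
  `k`), `isResidual_one_iff_fineGauge`, `isResidual_iff_toMS`; **«These transformations form a group»**:
  `residualGroup` (a `Subgroup` of `Site P 0 → G`; `mem_residualGroup`).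
* §2 **«The space of configurations U in (0.21) is invariant …»**: `iter_gaugeAct_of_isResidual` (`M^k(U^u) = M^k(U)`
  for residual `u`, `k ≤ m + K`), `gaugeAct_mem_surface_iff`, `surface_saturated`.
* §3 **«… and the functional (0.21) can be considered on orbits of this group»**: `OrbitRel` is an equivalence
  relation (`OrbitRel.refl/symm/trans`, `orbitSetoid`), the Wilson functional is constant on orbits
  (`wilsonAction4_eq_of_orbitRel`) and descends to the orbit space (`wilsonOnOrbits`, `wilsonOnOrbits_mk`), also after
  restriction to the constraint surface (`surfaceSetoid`, `functional021OnOrbits`, `functional021OnOrbits_mk`).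
* §4 «a set of minima»: for a class `reg` of regular configurations stable under the residual group (e.g. every
  plaquette small-field class, `plaqSmall_gaugeAct_iff'`), the minimisers of (0.21) form a union of orbits:
  `isBackground_gaugeAct`, `isBackground_iff_of_orbitRel` — so «a configuration in this orbit» `U_k(V)` is determined
  up to exactly this group (existence/uniqueness of the orbit itself = [15] Thm 1, not claimed).
* §5 **p. 263 «⇒ the action A_k(U) … is gauge invariant with respect to all G-valued transformations»**, at the level
  at which the tree types `A_k`: from `SFHyp.gaugeInv119` (1.19) and the intertwining hypothesis `hι`:
  `Etot_ofBackground_gaugeAct` (each `𝐄^{(j)}(g, U)`, `1 ≤ j ≤ k`), `Ek_gaugeAct` (`𝐄_k` of (0.23)), `action16_gaugeAct` /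
  `gaugeInvariant_action16` ((1.6) = (0.22)), `action13_gaugeAct` / `gaugeInvariant_action13` ((1.3), given the
  invariance of the explicit terms `log Z^{(j)}` — «an easily verifiable statement for all explicitly defined terms»,
  an abstract datum of the tower, hence a named hypothesis `hZ`).
* §6 **p. 256 (0.22) «A_k(g_k, V) = A_k(g_k, U_k(V))»**: the value does not depend on the representative of the orbit —
  `action16_eq_of_orbitRel`, `action13_eq_of_orbitRel`, and `action16_eq_of_isBackground_pair` (two minimisers in one
  residual orbit give the same action); **p. 265 «This does not change the expressions in (2.1) because this gauge
  transformation is equal to 1 on T⁽ᵏ⁾»**: `exprs21_invariant` (a residual `u` leaves `V = M^k(U)`, `A(U)` and `𝐄_k(U)` —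
  everything (2.1) is built from — unchanged).
* §7 MODEL INSTANCE of the intertwining hypothesis: `comp_gaugeAct_eq_gaugeU`, `ofBackground_hom_gaugeAct`,
  `intertwines_of_model` (for towers with `Φ = FieldPair P 0 𝔸ˣ 𝔸`, `act = B12RegularSpaces111.act`,
  `ofBackground U = B12Eq18Current.ofBackground π ξ (ρ ∘ U)`), `action16_gaugeAct_model`; the model towers
  themselves (`modelTower`: any term data completed by the concrete (1.9)/(1.10)): `modelTower_intertwines`,
  `gaugeInvariant_action16_modelTower` (p. 263 with NO hypothesis beyond `SFHyp`).
NOT here: the existence and uniqueness of the minimal orbit ([15] Thm 1, `B11.Thm1Printed`); the kernel-level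
residual invariance of the (0.13) integrand (p. 254; one level: `B12RTGaugeInvariance254`, unit r09 gen 6); the
concrete averages (0.11)/(0.12) (`B12ContourAverage253`).  No `Prop` placeholder is introduced; axioms standard.
-/

namespace Literature.MathematicalPhysics.QuantumFieldTheory.Balaban1983to89.B12GaugeOrbits021

open Literature.MathematicalPhysics.QuantumFieldTheory.Balaban1983to89
open B15DeterminingSets B16Sect1Backgrounds B12RTGaugeInvariance254 GaugeField

noncomputable section

/-! ## §1. The residual gauge transformations of level `k`: «u = 1 on T⁽ᵏ⁾», «These transformations form a group» -/

section Residual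

variable {P : Params} {G : Type*} [GaugeGroup G]

/-- **p. 256: «the gauge transformations u defined on T and satisfying the condition u = 1 on T⁽ᵏ⁾»** — a gauge
transformation of the finest torus is RESIDUAL OF LEVEL `k` when it is trivial at the sites of the `k`-th lattice
(`T⁽ᵏ⁾ ⊂ T` by `embIter k`). [cite: Balaban1987RG1, (0.21) p.256] -/
def IsResidual (k : ℕ) (u : GaugeTransf P 0 G) : Prop := ∀ y : Site P k, u (embIter k y) = 1

/-- At level `0` only the trivial transformation is residual (`T⁽⁰⁾ = T`). [cite: Balaban1987RG1, (0.21) p.256] -/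
theorem isResidual_zero_iff (u : GaugeTransf P 0 G) : IsResidual 0 u ↔ u = fun _ => 1 :=
  ⟨fun h => funext fun x => h x, fun h y => by rw [h]⟩

/-- `T⁽ᵏ⁺¹⁾ ⊂ T⁽ᵏ⁾`: a transformation trivial on `T⁽ᵏ⁾` is trivial on `T⁽ᵏ⁺¹⁾` (`embIter (k+1) y = embIter k (emb y)`).
[cite: Balaban1987RG1, (0.21) p.256] -/
theorem IsResidual.succ {k : ℕ} {u : GaugeTransf P 0 G} (h : IsResidual k u) : IsResidual (k+1) u :=
  fun y => h (emb y)

/-- The residual classes increase with the level: `u = 1` on `T⁽ᵏ⁾` implies `u = 1` on `T⁽ᵏ'⁾` for `k ≤ k'`.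
[cite: Balaban1987RG1, (0.21) p.256] -/
theorem IsResidual.mono {k k' : ℕ} {u : GaugeTransf P 0 G} (h : IsResidual k u) (hk : k ≤ k') : IsResidual k' u := by
  induction hk with
  | refl => exact h
  | step _ ih => exact ih.succ

/-- In the letters of the restrictions `u ↦ u↾T⁽ᵏ⁾ = toMS u k`: residual of level `k` iff the restriction to `T⁽ᵏ⁾`
is the trivial transformation. [cite: Balaban1987RG1, (0.21) p.256] -/
theorem isResidual_iff_toMS (k : ℕ) (u : GaugeTransf P 0 G) : IsResidual k u ↔ toMS u k = fun _ => 1 :=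
  ⟨fun h => funext fun y => h y, fun h y => congrFun h y⟩

/-- For `k = 1` the residual transformations are the «u(y) = 1 for y ∈ T⁽¹⁾» of p. 254, i.e. the tree's one-level
`B12FaddeevPopov016.FineGauge`. [cite: Balaban1987RG1, (0.13) p.254] -/
theorem isResidual_one_iff_fineGauge (u : GaugeTransf P 0 G) :
    IsResidual 1 u ↔ B12FaddeevPopov016.FineGauge u := Iff.rfl

/-- **p. 256: «These transformations form a group»** — the residual gauge transformations of level `k` form a
subgroup of the group `T → G` of all gauge transformations of `T` (pointwise operations). [cite: Balaban1987RG1, (0.21) p.256] -/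
def residualGroup (P : Params) (G : Type*) [GaugeGroup G] (k : ℕ) : Subgroup (Site P 0 → G) where
  carrier := {u | IsResidual k u}
  mul_mem' {u v} hu hv := fun y => by
    show u (embIter k y) * v (embIter k y) = 1
    rw [hu y, hv y, mul_one]
  one_mem' := fun _ => rfl
  inv_mem' {u} hu := fun y => by
    show (u (embIter k y))⁻¹ = 1
    rw [hu y, inv_one]

/-- Membership in the residual group is the residual condition. [cite: Balaban1987RG1, (0.21) p.256] -/
@[simp] theorem mem_residualGroup {k : ℕ} {u : Site P 0 → G} : u ∈ residualGroup P G k ↔ IsResidual k u := Iff.rfl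

/-- The residual groups increase with the level. [cite: Balaban1987RG1, (0.21) p.256] -/
theorem residualGroup_mono {k k' : ℕ} (hk : k ≤ k') : residualGroup P G k ≤ residualGroup P G k' :=
  fun _ hu => IsResidual.mono hu hk

/-- The pointwise product of two gauge transformations acts as the composite: `(U^v)^u = U^{uv}`
(`B16Sect1Backgrounds.gaugeAct_gaugeAct`, `mulG u v = u * v`). [cite: Balaban1987RG1, (1.10) p.262] -/
theorem gaugeAct_mul (u v : Site P 0 → G) (U : GaugeField P 0 G) :
    gaugeAct (u * v : Site P 0 → G) U = gaugeAct u (gaugeAct v U) :=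
  (gaugeAct_gaugeAct u v U).symm

/-- The pointwise inverse undoes the action: `(U^u)^{u⁻¹} = U` (`B12RTGaugeInvariance254.gaugeAct_inv_gaugeAct`,
`invTransf u = u⁻¹`). [cite: Balaban1987RG1, (1.10) p.262] -/
theorem gaugeAct_inv (u : Site P 0 → G) (U : GaugeField P 0 G) :
    gaugeAct (u⁻¹ : Site P 0 → G) (gaugeAct u U) = U :=
  gaugeAct_inv_gaugeAct u U

end Residual

/-! ## §2. «The space of configurations U in (0.21) is invariant with respect to [the residual] gauge transformations» -/

section Surface

variable {P : Params} {G : Type*} [GaugeGroup G]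

/-- **THE MECHANISM**: a residual transformation of level `k` does not move the `k`-fold average, `M^k(U^u) = M^k(U)`
(gauge covariance of the iterated averages `M^k(U^u) = (M^k U)^{u↾T⁽ᵏ⁾}`, `B16Sect1Backgrounds.iter_gaugeAct`, and
`u↾T⁽ᵏ⁾ = 1`), in the standing range `k ≤ m + K` of `Params`. [cite: Balaban1987RG1, (0.21) p.256] -/
theorem iter_gaugeAct_of_isResidual (av : ∀ i, Averaging P i G) {k : ℕ} (hk : k ≤ P.m + P.K)
    {u : GaugeTransf P 0 G} (hu : IsResidual k u) (U : GaugeField P 0 G) :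
    Averaging.iter av k (gaugeAct u U) = Averaging.iter av k U := by
  rw [iter_gaugeAct av u U k hk]
  funext b
  show u (embIter k b.src) * Averaging.iter av k U b * (u (embIter k b.tgt))⁻¹ = Averaging.iter av k U b
  rw [hu, hu, inv_one, one_mul, mul_one]

/-- **«the space of configurations U in (0.21)»**: the constraint surface `{U : Ū^k = M^k(U) = V}` of a coarse
configuration `V` on `T⁽ᵏ⁾`. [cite: Balaban1987RG1, (0.21) p.256] -/
def surface (av : ∀ i, Averaging P i G) (k : ℕ) (V : GaugeField P k G) : Set (GaugeField P 0 G) :=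
  {U | Averaging.iter av k U = V}

/-- Membership in the constraint surface (definitional). [cite: Balaban1987RG1, (0.21) p.256] -/
@[simp] theorem mem_surface {av : ∀ i, Averaging P i G} {k : ℕ} {V : GaugeField P k G} {U : GaugeField P 0 G} :
    U ∈ surface av k V ↔ Averaging.iter av k U = V := Iff.rfl

/-- **p. 256: «The space of configurations U in (0.21) is invariant with respect to the gauge transformations u
defined on T and satisfying the condition u = 1 on T⁽ᵏ⁾»** (`k ≤ m + K`). [cite: Balaban1987RG1, (0.21) p.256] -/
theorem gaugeAct_mem_surface_iff (av : ∀ i, Averaging P i G) {k : ℕ} (hk : k ≤ P.m + P.K) {u : GaugeTransf P 0 G}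
    (hu : IsResidual k u) (V : GaugeField P k G) (U : GaugeField P 0 G) :
    gaugeAct u U ∈ surface av k V ↔ U ∈ surface av k V := by
  rw [mem_surface, mem_surface, iter_gaugeAct_of_isResidual av hk hu]

end Surface

/-! ## §3. «… and the functional (0.21) can be considered on orbits of this group» -/

section Orbits

variable {P : Params} {G : Type*} [GaugeGroup G]

/-- Two configurations of `T` lie in one ORBIT of the residual group of level `k`: `U' = U^u` for a residual `u`.
[cite: Balaban1987RG1, (0.21) p.256] -/
def OrbitRel (k : ℕ) (U U' : GaugeField P 0 G) : Prop := ∃ u : Site P 0 → G, IsResidual k u ∧ U' = gaugeAct u U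

/-- Orbits: reflexivity (`u = 1`). [cite: Balaban1987RG1, (0.21) p.256] -/
theorem OrbitRel.refl (k : ℕ) (U : GaugeField P 0 G) : OrbitRel k U U :=
  ⟨1, (residualGroup P G k).one_mem, (gaugeAct_one' U).symm⟩

/-- Orbits: symmetry (`u ↦ u⁻¹`). [cite: Balaban1987RG1, (0.21) p.256] -/
theorem OrbitRel.symm {k : ℕ} {U U' : GaugeField P 0 G} (h : OrbitRel k U U') : OrbitRel k U' U := by
  obtain ⟨u, hu, rfl⟩ := h
  exact ⟨(u⁻¹ : Site P 0 → G), (residualGroup P G k).inv_mem hu, (gaugeAct_inv u U).symm⟩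

/-- Orbits: transitivity (`(u, v) ↦ vu`). [cite: Balaban1987RG1, (0.21) p.256] -/
theorem OrbitRel.trans {k : ℕ} {U U' U'' : GaugeField P 0 G} (h : OrbitRel k U U') (h' : OrbitRel k U' U'') :
    OrbitRel k U U'' := by
  obtain ⟨u, hu, rfl⟩ := h
  obtain ⟨v, hv, rfl⟩ := h'
  exact ⟨(v * u : Site P 0 → G), (residualGroup P G k).mul_mem hv hu, (gaugeAct_mul v u U).symm⟩

/-- The orbit relation of a coarser level is implied by that of a finer one (the groups increase with `k`).
[cite: Balaban1987RG1, (0.21) p.256] -/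
theorem OrbitRel.mono {k k' : ℕ} {U U' : GaugeField P 0 G} (h : OrbitRel k U U') (hk : k ≤ k') : OrbitRel k' U U' := by
  obtain ⟨u, hu, rfl⟩ := h
  exact ⟨u, hu.mono hk, rfl⟩

/-- **«orbits of this group»**: the orbit equivalence relation of the residual group of level `k` on the
configurations of `T`. [cite: Balaban1987RG1, (0.21) p.256] -/
def orbitSetoid (P : Params) (G : Type*) [GaugeGroup G] (k : ℕ) : Setoid (GaugeField P 0 G) where
  r := OrbitRel k
  iseqv := ⟨OrbitRel.refl k, OrbitRel.symm, OrbitRel.trans⟩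

/-- The constraint surface of (0.21) is a union of orbits (saturated), `k ≤ m + K`. [cite: Balaban1987RG1, (0.21) p.256] -/
theorem surface_saturated (av : ∀ i, Averaging P i G) {k : ℕ} (hk : k ≤ P.m + P.K) (V : GaugeField P k G)
    {U U' : GaugeField P 0 G} (hU : U ∈ surface av k V) (h : OrbitRel k U U') : U' ∈ surface av k V := by
  obtain ⟨u, hu, rfl⟩ := h
  exact (gaugeAct_mem_surface_iff av hk hu V U).2 hU

/-- The far corner of a plaquette does not depend on the order of the two steps (twin of the private lemmas of
`B8Eq111SiteCovariance`/`LatticeFieldCalculus`, re-proved to keep this file's imports small). [folklore] -/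
private theorem shift_shift_comm {j : ℕ} (x : Site P j) (μ ν : Fin P.d) : (x.shift μ).shift ν = (x.shift ν).shift μ := by
  funext κ
  by_cases h1 : κ = ν
  · subst h1
    by_cases h2 : κ = μ
    · subst h2; rfl
    · simp [Site.shift, Function.update_of_ne h2]
  · by_cases h2 : κ = μ
    · subst h2
      simp [Site.shift, Function.update_of_ne h1]
    · simp [Site.shift, Function.update_of_ne h1, Function.update_of_ne h2]

/-- `U^u(∂p) = u(p₋)U(∂p)u(p₋)⁻¹` (twin of `T4ReTrLipUnitary.plaqHol_gaugeAct`, re-proved to keep this file's imports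
small). [folklore] -/
private theorem plaqHol_gaugeAct' {j : ℕ} (u : GaugeTransf P j G) (U : GaugeField P j G) (p : Plaq P j) :
    plaqHol (gaugeAct u U) p = u p.src * plaqHol U p * (u p.src)⁻¹ := by
  simp only [plaqHol, gaugeAct, PBond.tgt, shift_shift_comm p.src p.ν p.μ, mul_inv_rev, inv_inv]
  group

/-- Gauge invariance of the Wilson action `A(U^u) = A(U)` (twin of `B14Eq16FaddeevPopov.wilsonAction4_gaugeAct'` /
`T4WilsonGaugeFlatDirection.wilsonAction_gaugeAct`, re-proved to keep this file's imports small). [folklore] -/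
private theorem wilsonAction4_gaugeAct {j : ℕ} (u : GaugeTransf P j G) (U : GaugeField P j G) :
    wilsonAction4 (gaugeAct u U) = wilsonAction4 U := by
  unfold wilsonAction4 wilsonAction
  simp only [plaqHol_gaugeAct', GaugeGroup.reTr_conj]

/-- **The functional (0.21) is constant on the orbits**: `A^η(U') = A^η(U)` whenever `U'` lies in the residual orbit
of `U` (gauge invariance of the Wilson action, `Re tr (h g h⁻¹) = Re tr g`). [cite: Balaban1987RG1, (0.21) p.256] -/
theorem wilsonAction4_eq_of_orbitRel {k : ℕ} {U U' : GaugeField P 0 G} (h : OrbitRel k U U') :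
    wilsonAction4 U' = wilsonAction4 U := by
  obtain ⟨u, -, rfl⟩ := h
  exact wilsonAction4_gaugeAct u U

/-- **p. 256: «the functional (0.21) can be considered on orbits of this group»** — the Wilson functional DESCENDS to
the orbit space of the residual group (a well-defined function of the orbit). [cite: Balaban1987RG1, (0.21) p.256] -/
def wilsonOnOrbits (P : Params) (G : Type*) [GaugeGroup G] (k : ℕ) : Quotient (orbitSetoid P G k) → ℝ :=
  Quotient.lift wilsonAction4 fun _ _ h => (wilsonAction4_eq_of_orbitRel h).symm

/-- The descended functional evaluated on the orbit of `U` is `A^η(U)`. [cite: Balaban1987RG1, (0.21) p.256] -/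
@[simp] theorem wilsonOnOrbits_mk (k : ℕ) (U : GaugeField P 0 G) :
    wilsonOnOrbits P G k (Quotient.mk (orbitSetoid P G k) U) = wilsonAction4 U := rfl

/-- The orbit relation RESTRICTED to the constraint surface `{M^k(U) = V}` (which is a union of orbits,
`surface_saturated`): the orbits «of this group» inside «the space of configurations U in (0.21)».
[cite: Balaban1987RG1, (0.21) p.256] -/
def surfaceSetoid (av : ∀ i, Averaging P i G) (k : ℕ) (V : GaugeField P k G) : Setoid (surface av k V) :=
  (orbitSetoid P G k).comap (Subtype.val : surface av k V → GaugeField P 0 G)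

/-- **THE FUNCTIONAL (0.21) ON ORBITS**: `U ↦ A^η(U)`, `U : M^k(U) = V`, as a function on the orbit space of the
residual group acting on the constraint surface. [cite: Balaban1987RG1, (0.21) p.256] -/
def functional021OnOrbits (av : ∀ i, Averaging P i G) (k : ℕ) (V : GaugeField P k G) :
    Quotient (surfaceSetoid av k V) → ℝ :=
  Quotient.lift (fun U : surface av k V => wilsonAction4 U.1)
    fun _ _ h => (wilsonAction4_eq_of_orbitRel (k := k) h).symm

/-- The functional on orbits evaluated on the orbit of a point `U` of the surface is `A^η(U)`. [cite: Balaban1987RG1, (0.21) p.256] -/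
@[simp] theorem functional021OnOrbits_mk (av : ∀ i, Averaging P i G) (k : ℕ) (V : GaugeField P k G)
    (U : surface av k V) :
    functional021OnOrbits av k V (Quotient.mk (surfaceSetoid av k V) U) = wilsonAction4 U.1 := rfl

end Orbits

/-! ## §4. «a set of minima»: the minimisers of (0.21) form a union of residual orbits -/

section Minima

variable {P : Params} {G : Type*} [GaugeGroup G]

/-- The plaquette small-field classes `{U : |U(∂p) − 1| < δ}` — the «regular configurations» of p. 254 — are gauge
invariant (twin of `T4ReTrLipUnitary.plaqSmall_gaugeAct_iff`; `dist1 (h g h⁻¹) = dist1 g`), so they qualify as the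
class `reg` below. [cite: Balaban1987RG1, (0.13) p.254] -/
theorem plaqSmall_gaugeAct_iff' {j : ℕ} (δ : ℝ) (u : GaugeTransf P j G) (U : GaugeField P j G) :
    PlaqSmall δ (gaugeAct u U) ↔ PlaqSmall δ U := by
  simp only [PlaqSmall, plaqHol_gaugeAct', GaugeGroup.dist1_conj]

/-- **p. 256: «exactly one critical orbit, which is a set of minima of the function (0.21). We denote a configuration
in this orbit by U_k(V)»** — the part that is bookkeeping over (0.21): if `U₀` minimises `A^η` on
`{M^k(U) = V} ∩ reg` for a class `reg` of regular configurations stable under the residual group of level `k`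
(`k ≤ m + K`), then so does every `U₀^u` with `u` residual — the minimisers form a union of orbits, and «a
configuration in this orbit» is determined up to exactly this group.  (Existence and uniqueness of the minimal ORBIT is
[15] Thm 1 — a quoted leaf, not claimed.) [cite: Balaban1987RG1, (0.21) p.256] -/
theorem isBackground_gaugeAct {av : ∀ i, Averaging P i G} {reg : Set (GaugeField P 0 G)} {k : ℕ}
    (hk : k ≤ P.m + P.K) (hreg : ∀ u : GaugeTransf P 0 G, IsResidual k u → ∀ U ∈ reg, gaugeAct u U ∈ reg)
    {V : GaugeField P k G} {U₀ : GaugeField P 0 G} (h : IsBackground av reg k V U₀)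
    {u : GaugeTransf P 0 G} (hu : IsResidual k u) : IsBackground av reg k V (gaugeAct u U₀) := by
  refine ⟨?_, hreg u hu U₀ h.2.1, fun U hU hUV => ?_⟩
  · rw [iter_gaugeAct_of_isResidual av hk hu]
    exact h.1
  · rw [wilsonAction4_gaugeAct]
    exact h.2.2 U hU hUV

/-- The minimising property is a property of the ORBIT: for `U₀, U₀'` in one residual orbit of level `k`, one is a
minimiser of (0.21) iff the other is. [cite: Balaban1987RG1, (0.21) p.256] -/
theorem isBackground_iff_of_orbitRel {av : ∀ i, Averaging P i G} {reg : Set (GaugeField P 0 G)} {k : ℕ}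
    (hk : k ≤ P.m + P.K) (hreg : ∀ u : GaugeTransf P 0 G, IsResidual k u → ∀ U ∈ reg, gaugeAct u U ∈ reg)
    (V : GaugeField P k G) {U₀ U₀' : GaugeField P 0 G} (h : OrbitRel k U₀ U₀') :
    IsBackground av reg k V U₀ ↔ IsBackground av reg k V U₀' := by
  constructor
  · intro hb
    obtain ⟨u, hu, rfl⟩ := h
    exact isBackground_gaugeAct hk hreg hb hu
  · intro hb
    obtain ⟨u, hu, rfl⟩ := h.symm
    exact isBackground_gaugeAct hk hreg hb hu

/-- The plaquette small-field class `{U : |U(∂p) − 1| < δ}` is stable under every gauge transformation, in particular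
under the residual ones — a legitimate `reg` for `isBackground_gaugeAct`. [cite: Balaban1987RG1, (0.13) p.254] -/
theorem plaqSmall_stable (δ : ℝ) (k : ℕ) :
    ∀ u : GaugeTransf P 0 G, IsResidual k u → ∀ U ∈ {U : GaugeField P 0 G | PlaqSmall δ U},
      gaugeAct u U ∈ {U : GaugeField P 0 G | PlaqSmall δ U} :=
  fun u _ U hU => (plaqSmall_gaugeAct_iff' δ u U).2 hU

end Minima

/-! ## §5. p. 263: «These assumptions imply that the action A_k(U) … is gauge invariant with respect to all G-valued
transformations» — at the level of the tower `Step.SFTower` carrying (1.3)/(1.6) -/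

section Tower

open Step

variable {P : Params} {G : Type*} [GaugeGroup G] {Φ 𝒢 : Type*}

/-- Each localized sum `𝐄^{(j)}(g, U) = Σ_X 𝐄^{(j)}(X, g, U, J(U))`, `1 ≤ j ≤ k`, is gauge invariant in the background
`U`, GIVEN (1.19) for the terms (`SFHyp.gaugeInv119`) and the intertwining of the substitution (1.9) with the action
(1.10): `(U^u, J(U^u)) = (U, J(U))^{ι u}` (hypothesis `hι`; discharged for the concrete substitution in §7).
[cite: Balaban1987RG1, (1.19) p.263] -/
theorem Etot_ofBackground_gaugeAct (T : SFTower P G Φ 𝒢) {c : SFConsts} {k : ℕ} (h : SFHyp T c k)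
    (ι : GaugeTransf P 0 G → 𝒢) (hι : ∀ u U, T.ofBackground (gaugeAct u U) = T.act (ι u) (T.ofBackground U))
    {j : ℕ} (h1 : 1 ≤ j) (hj : j ≤ k) (g : ℝ) (u : GaugeTransf P 0 G) (U : GaugeField P 0 G) :
    T.Etot j g (T.ofBackground (gaugeAct u U)) = T.Etot j g (T.ofBackground U) := by
  unfold SFTower.Etot
  rw [hι]
  exact Finset.sum_congr rfl fun X _ => h.gaugeInv119 j h1 hj X g (ι u) (T.ofBackground U)

/-- `𝐄_k(U^u) = 𝐄_k(U)` for the sum (0.23) = the `j`-sum of (1.6) (the Wilson terms `−β_{j+1}(g_j)A(U)` by gauge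
invariance of `A`, the terms `𝐄^{(j+1)}(g_j, U) − 𝐄^{(j+1)}(g_j, 1)` by `Etot_ofBackground_gaugeAct`).
[cite: Balaban1987RG1, (0.23) p.256] -/
theorem Ek_gaugeAct (T : SFTower P G Φ 𝒢) {c : SFConsts} {k : ℕ} (h : SFHyp T c k)
    (ι : GaugeTransf P 0 G → 𝒢) (hι : ∀ u U, T.ofBackground (gaugeAct u U) = T.act (ι u) (T.ofBackground U))
    (u : GaugeTransf P 0 G) (U : GaugeField P 0 G) : T.Ek k (gaugeAct u U) = T.Ek k U := by
  unfold SFTower.Ek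
  refine Finset.sum_congr rfl fun j hj => ?_
  rw [wilsonAction4_gaugeAct,
    Etot_ofBackground_gaugeAct T h ι hι (Nat.succ_pos j) (Finset.mem_range.mp hj) (T.flow.g j) u U]

/-- **p. 263, for the form (1.6) = (0.22)–(0.23): `A_k(U^u) = A_k(U)` for every (`G`-valued) gauge transformation
`u` of `T`** — from (1.19) and the intertwining of (1.9) with (1.10). [cite: Balaban1987RG1, (1.19) p.263] -/
theorem action16_gaugeAct (T : SFTower P G Φ 𝒢) {c : SFConsts} {k : ℕ} (h : SFHyp T c k)
    (ι : GaugeTransf P 0 G → 𝒢) (hι : ∀ u U, T.ofBackground (gaugeAct u U) = T.act (ι u) (T.ofBackground U))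
    (u : GaugeTransf P 0 G) (U : GaugeField P 0 G) : T.action16 k (gaugeAct u U) = T.action16 k U := by
  rw [SFTower.action16_eq, SFTower.action16_eq, wilsonAction4_gaugeAct, Ek_gaugeAct T h ι hι u U]

/-- **p. 263 «the action A_k(U) … is gauge invariant with respect to all G-valued transformations»** (form (1.6)), as
the tree's predicate `GaugeField.GaugeInvariant`. [cite: Balaban1987RG1, (1.19) p.263] -/
theorem gaugeInvariant_action16 (T : SFTower P G Φ 𝒢) {c : SFConsts} {k : ℕ} (h : SFHyp T c k)
    (ι : GaugeTransf P 0 G → 𝒢) (hι : ∀ u U, T.ofBackground (gaugeAct u U) = T.act (ι u) (T.ofBackground U)) :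
    GaugeInvariant (T.action16 k) :=
  fun u U => action16_gaugeAct T h ι hι u U

/-- **p. 263, for the form (1.3)** (zeroth-order terms `log Z^{(j)}(U) − log Z^{(j)}(1)` separated): `A_k(U^u) = A_k(U)`,
given in addition the gauge invariance of the explicit terms `log Z^{(j)}`, `j < k` — «This assumption is an easily
verifiable statement for all explicitly defined terms in the action (1.3)»; `log Z^{(j)}` is an abstract datum of the
tower, so its invariance is the named hypothesis `hZ`. [cite: Balaban1987RG1, (1.3) p.260] -/
theorem action13_gaugeAct (T : SFTower P G Φ 𝒢) {c : SFConsts} {k : ℕ} (h : SFHyp T c k)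
    (ι : GaugeTransf P 0 G → 𝒢) (hι : ∀ u U, T.ofBackground (gaugeAct u U) = T.act (ι u) (T.ofBackground U))
    (hZ : ∀ j, j < k → ∀ (u : GaugeTransf P 0 G) (U : GaugeField P 0 G), T.logZ j (gaugeAct u U) = T.logZ j U)
    (u : GaugeTransf P 0 G) (U : GaugeField P 0 G) : T.action13 k (gaugeAct u U) = T.action13 k U := by
  unfold SFTower.action13
  rw [wilsonAction4_gaugeAct]
  congr 1
  refine Finset.sum_congr rfl fun j hj => ?_
  have hjk : j < k := Finset.mem_range.mp hj
  rw [hZ j hjk u U, Etot_ofBackground_gaugeAct T h ι hι (Nat.succ_pos j) hjk (T.flow.g j) u U]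

/-- **p. 263** (form (1.3)), as the tree's predicate `GaugeField.GaugeInvariant`. [cite: Balaban1987RG1, (1.3) p.260] -/
theorem gaugeInvariant_action13 (T : SFTower P G Φ 𝒢) {c : SFConsts} {k : ℕ} (h : SFHyp T c k)
    (ι : GaugeTransf P 0 G → 𝒢) (hι : ∀ u U, T.ofBackground (gaugeAct u U) = T.act (ι u) (T.ofBackground U))
    (hZ : ∀ j, j < k → ∀ (u : GaugeTransf P 0 G) (U : GaugeField P 0 G), T.logZ j (gaugeAct u U) = T.logZ j U) :
    GaugeInvariant (T.action13 k) :=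
  fun u U => action13_gaugeAct T h ι hι hZ u U

end Tower

/-! ## §6. (0.22) «A_k(g_k, V) = A_k(g_k, U_k(V))»: independence of the representative; p. 265 «This does not change
the expressions in (2.1) because this gauge transformation is equal to 1 on T⁽ᵏ⁾» -/

section Representative

open Step

variable {P : Params} {G : Type*} [GaugeGroup G] {Φ 𝒢 : Type*}

/-- **(0.22) is well posed on the orbit**: two configurations in one residual orbit (of any level `k'`) have the same
action `A_k` in the form (1.6) — so «A_k(g_k, V) = A_k(g_k, U_k(V))» does not depend on which configuration of the
minimal orbit is called `U_k(V)`. [cite: Balaban1987RG1, (0.22) p.256] -/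
theorem action16_eq_of_orbitRel (T : SFTower P G Φ 𝒢) {c : SFConsts} {k : ℕ} (h : SFHyp T c k)
    (ι : GaugeTransf P 0 G → 𝒢) (hι : ∀ u U, T.ofBackground (gaugeAct u U) = T.act (ι u) (T.ofBackground U))
    {k' : ℕ} {U₀ U₀' : GaugeField P 0 G} (hrel : OrbitRel k' U₀ U₀') : T.action16 k U₀' = T.action16 k U₀ := by
  obtain ⟨u, -, rfl⟩ := hrel
  exact action16_gaugeAct T h ι hι u U₀

/-- The same for the form (1.3), given the invariance of the explicit terms `log Z^{(j)}`. [cite: Balaban1987RG1, (0.22) p.256] -/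
theorem action13_eq_of_orbitRel (T : SFTower P G Φ 𝒢) {c : SFConsts} {k : ℕ} (h : SFHyp T c k)
    (ι : GaugeTransf P 0 G → 𝒢) (hι : ∀ u U, T.ofBackground (gaugeAct u U) = T.act (ι u) (T.ofBackground U))
    (hZ : ∀ j, j < k → ∀ (u : GaugeTransf P 0 G) (U : GaugeField P 0 G), T.logZ j (gaugeAct u U) = T.logZ j U)
    {k' : ℕ} {U₀ U₀' : GaugeField P 0 G} (hrel : OrbitRel k' U₀ U₀') : T.action13 k U₀' = T.action13 k U₀ := by
  obtain ⟨u, -, rfl⟩ := hrel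
  exact action13_gaugeAct T h ι hι hZ u U₀

/-- **«We denote a configuration in this orbit by U_k(V) … A_k(g_k, V) = A_k(g_k, U_k(V))»**: if `U₀` is a minimiser
of (0.21) for `V` (a background field, `Setup.IsBackground`) and `U₀'` lies in its residual orbit of level `k`, then
`U₀'` is a minimiser for the same `V` AND the action takes the same value — the datum `V ↦ U_k(V)` of
`Setup.Background` may be any selection from the orbit. [cite: Balaban1987RG1, (0.22) p.256] -/
theorem action16_eq_of_isBackground_pair {av : ∀ i, Averaging P i G} {reg : Set (GaugeField P 0 G)} {k : ℕ}
    (hk : k ≤ P.m + P.K) (hreg : ∀ u : GaugeTransf P 0 G, IsResidual k u → ∀ U ∈ reg, gaugeAct u U ∈ reg)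
    (T : SFTower P G Φ 𝒢) {c : SFConsts} (h : SFHyp T c k)
    (ι : GaugeTransf P 0 G → 𝒢) (hι : ∀ u U, T.ofBackground (gaugeAct u U) = T.act (ι u) (T.ofBackground U))
    {V : GaugeField P k G} {U₀ U₀' : GaugeField P 0 G} (hb : IsBackground av reg k V U₀) (hrel : OrbitRel k U₀ U₀') :
    IsBackground av reg k V U₀' ∧ T.action16 k U₀' = T.action16 k U₀ :=
  ⟨(isBackground_iff_of_orbitRel hk hreg V hrel).1 hb, action16_eq_of_orbitRel T h ι hι hrel⟩

/-- **p. 265: «we transform at first U′_k(V′) into the axial gauge Ax_k(T⁽ᵏ⁾, U_{k+1}). This does not change the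
expressions in (2.1) because this gauge transformation is equal to 1 on T⁽ᵏ⁾»** — a residual transformation `u` of
level `k` applied to the fine configuration `U` (`= U_k(V)`) leaves unchanged everything the integrand of (2.1) is
built from: the coarse field `V = M^k(U)` (hence the δ-functions, `χ_k`, the gauge-fixing term `G(V)`), the Wilson
action `A(U)`, and the sum `𝐄_k(U)` (`k ≤ m + K`; (1.19) + intertwining for `𝐄_k`). [cite: Balaban1987RG1, (2.3) p.265] -/
theorem exprs21_invariant (av : ∀ i, Averaging P i G) {k : ℕ} (hk : k ≤ P.m + P.K)
    (T : SFTower P G Φ 𝒢) {c : SFConsts} (h : SFHyp T c k)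
    (ι : GaugeTransf P 0 G → 𝒢) (hι : ∀ u U, T.ofBackground (gaugeAct u U) = T.act (ι u) (T.ofBackground U))
    {u : GaugeTransf P 0 G} (hu : IsResidual k u) (U : GaugeField P 0 G) :
    Averaging.iter av k (gaugeAct u U) = Averaging.iter av k U ∧
      wilsonAction4 (gaugeAct u U) = wilsonAction4 U ∧ T.Ek k (gaugeAct u U) = T.Ek k U :=
  ⟨iter_gaugeAct_of_isResidual av hk hu U, wilsonAction4_gaugeAct u U, Ek_gaugeAct T h ι hι u U⟩

end Representative

/-! ## §7. MODEL INSTANCE of the intertwining hypothesis: the concrete substitution (1.9) of `B12Eq18Current` -/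

section Model

open Step B12Eq18Current B12RegularSpaces111 B9Eq39Adjoint

variable {P : Params} {G : Type*} [GaugeGroup G] {𝔸 : Type*} [Ring 𝔸] [Algebra ℂ 𝔸]

omit [Algebra ℂ 𝔸] in
/-- A `G`-valued configuration read in the matrix algebra through a homomorphism `ρ : G →* 𝔸ˣ` transforms under
`U ↦ U^u` as the `𝔸ˣ`-valued configuration `ρ ∘ U` under `B12RegularSpaces111.gaugeU (ρ ∘ u)` (`ρ` multiplicative).
[cite: Balaban1987RG1, (1.10) p.262] -/
theorem comp_gaugeAct_eq_gaugeU {j : ℕ} (ρ : G →* 𝔸ˣ) (u : GaugeTransf P j G) (U : GaugeField P j G) :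
    (fun b => ρ (gaugeAct u U b)) = gaugeU (fun x => ρ (u x)) (fun b => ρ (U b)) := by
  funext b
  simp only [gaugeAct, gaugeU, map_mul, map_inv]

/-- **(1.9) intertwines (1.10) for `G`-valued data**: `(ρU^u, J(ρU^u)) = (ρU, J(ρU))^{ρu}` for the concrete substitution
`ofBackground π ξ` of `B12Eq18Current` (the current (1.8) with the projection `π` onto `𝔤ᶜ`, `π` commuting with the
adjoint action of `ρ(G)`), by `B12Eq18Current.ofBackground_gaugeU`. [cite: Balaban1987RG1, (1.10) p.262] -/
theorem ofBackground_hom_gaugeAct {j : ℕ} (π : 𝔸 →ₗ[ℂ] 𝔸) (ξ : ℝ) (ρ : G →* 𝔸ˣ)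
    (hπ : ∀ (g : G) (X : 𝔸), π (R (ρ g) X) = R (ρ g) (π X)) (u : GaugeTransf P j G) (U : GaugeField P j G) :
    B12Eq18Current.ofBackground π ξ (fun b => ρ (gaugeAct u U b)) =
      act (fun x => ρ (u x)) (B12Eq18Current.ofBackground π ξ (fun b => ρ (U b))) := by
  rw [comp_gaugeAct_eq_gaugeU]
  exact ofBackground_gaugeU π ξ (fun x => ρ (u x)) (fun x X => hπ (u x) X) (fun b => ρ (U b))

/-- **THE INTERTWINING HYPOTHESIS `hι` DISCHARGED** for every tower whose configuration-pair type is the concrete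
`FieldPair P 0 𝔸ˣ 𝔸`, whose gauge action is (1.10) `B12RegularSpaces111.act`, and whose substitution (1.9) is
`U ↦ (ρU, J(ρU))` = `B12Eq18Current.ofBackground π ξ (ρ ∘ U)`; the inclusion `ι` is `u ↦ ρ ∘ u`.
[cite: Balaban1987RG1, (1.19) p.263] -/
theorem intertwines_of_model (T : SFTower P G (FieldPair P 0 𝔸ˣ 𝔸) (Site P 0 → 𝔸ˣ))
    (π : 𝔸 →ₗ[ℂ] 𝔸) (ξ : ℝ) (ρ : G →* 𝔸ˣ) (hπ : ∀ (g : G) (X : 𝔸), π (R (ρ g) X) = R (ρ g) (π X))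
    (hof : ∀ U, T.ofBackground U = B12Eq18Current.ofBackground π ξ (fun b => ρ (U b)))
    (hact : ∀ v φ, T.act v φ = act v φ) :
    ∀ (u : GaugeTransf P 0 G) (U : GaugeField P 0 G),
      T.ofBackground (gaugeAct u U) = T.act (fun x => ρ (u x)) (T.ofBackground U) := by
  intro u U
  rw [hof, hof, hact, ofBackground_hom_gaugeAct π ξ ρ hπ u U]

/-- **p. 263 for the model towers, hypothesis-free in the intertwining**: `A_k(U^u) = A_k(U)` (form (1.6)) for every
tower over the concrete pairs with the concrete substitution, from (1.19) alone. [cite: Balaban1987RG1, (1.19) p.263] -/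
theorem action16_gaugeAct_model (T : SFTower P G (FieldPair P 0 𝔸ˣ 𝔸) (Site P 0 → 𝔸ˣ)) {c : SFConsts} {k : ℕ}
    (h : SFHyp T c k) (π : 𝔸 →ₗ[ℂ] 𝔸) (ξ : ℝ) (ρ : G →* 𝔸ˣ)
    (hπ : ∀ (g : G) (X : 𝔸), π (R (ρ g) X) = R (ρ g) (π X))
    (hof : ∀ U, T.ofBackground U = B12Eq18Current.ofBackground π ξ (fun b => ρ (U b)))
    (hact : ∀ v φ, T.act v φ = act v φ) (u : GaugeTransf P 0 G) (U : GaugeField P 0 G) :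
    T.action16 k (gaugeAct u U) = T.action16 k U :=
  action16_gaugeAct T h (fun u x => ρ (u x)) (intertwines_of_model T π ξ ρ hπ hof hact) u U

/-- THE MODEL TOWERS (non-vacuity of the hypotheses `hof`, `hact` of `intertwines_of_model`): any tower data
(couplings, localization domains, terms `𝐄^{(j)}(X, g, ·)` on the concrete pairs, spaces, locality relation,
`log Z^{(j)}`) completed by the concrete gauge action (1.10) and the concrete substitution (1.9) read through `ρ`.
[cite: Balaban1987RG1, (1.9) p.261] -/
def modelTower (π : 𝔸 →ₗ[ℂ] 𝔸) (ξ : ℝ) (ρ : G →* 𝔸ˣ) (flow : Flow) (sys : ℕ → LocDomainSys)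
    (E : (j : ℕ) → (sys j).Dom → ℝ → FieldPair P 0 𝔸ˣ 𝔸 → ℂ)
    (space : (j : ℕ) → (sys j).Dom → ℝ → ℝ → Set (FieldPair P 0 𝔸ˣ 𝔸))
    (agreeOn : (j : ℕ) → (sys j).Dom → FieldPair P 0 𝔸ˣ 𝔸 → FieldPair P 0 𝔸ˣ 𝔸 → Prop)
    (logZ : ℕ → GaugeField P 0 G → ℝ) : SFTower P G (FieldPair P 0 𝔸ˣ 𝔸) (Site P 0 → 𝔸ˣ) where
  flow := flow
  sys := sys
  E := E
  space := space
  ofBackground := fun U => B12Eq18Current.ofBackground π ξ (fun b => ρ (U b))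
  act := act
  agreeOn := agreeOn
  logZ := logZ

/-- For the model towers the intertwining hypothesis `hι` HOLDS (with `ι u = ρ ∘ u`), for `π` commuting with the
adjoint action of `ρ(G)`. [cite: Balaban1987RG1, (1.19) p.263] -/
theorem modelTower_intertwines (π : 𝔸 →ₗ[ℂ] 𝔸) (ξ : ℝ) (ρ : G →* 𝔸ˣ)
    (hπ : ∀ (g : G) (X : 𝔸), π (R (ρ g) X) = R (ρ g) (π X)) (flow : Flow) (sys : ℕ → LocDomainSys)
    (E : (j : ℕ) → (sys j).Dom → ℝ → FieldPair P 0 𝔸ˣ 𝔸 → ℂ)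
    (space : (j : ℕ) → (sys j).Dom → ℝ → ℝ → Set (FieldPair P 0 𝔸ˣ 𝔸))
    (agreeOn : (j : ℕ) → (sys j).Dom → FieldPair P 0 𝔸ˣ 𝔸 → FieldPair P 0 𝔸ˣ 𝔸 → Prop)
    (logZ : ℕ → GaugeField P 0 G → ℝ) (u : GaugeTransf P 0 G) (U : GaugeField P 0 G) :
    (modelTower π ξ ρ flow sys E space agreeOn logZ).ofBackground (gaugeAct u U) =
      (modelTower π ξ ρ flow sys E space agreeOn logZ).act (fun x => ρ (u x))
        ((modelTower π ξ ρ flow sys E space agreeOn logZ).ofBackground U) :=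
  intertwines_of_model _ π ξ ρ hπ (fun _ => rfl) (fun _ _ => rfl) u U

/-- **p. 263 for the model towers**: under the inductive hypotheses `SFHyp` at scale `k` (in particular (1.19)), the
action (1.6) of a model tower is gauge invariant with respect to all `G`-valued gauge transformations of `T` — no
further hypothesis. [cite: Balaban1987RG1, (1.19) p.263] -/
theorem gaugeInvariant_action16_modelTower (π : 𝔸 →ₗ[ℂ] 𝔸) (ξ : ℝ) (ρ : G →* 𝔸ˣ)
    (hπ : ∀ (g : G) (X : 𝔸), π (R (ρ g) X) = R (ρ g) (π X)) (flow : Flow) (sys : ℕ → LocDomainSys)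
    (E : (j : ℕ) → (sys j).Dom → ℝ → FieldPair P 0 𝔸ˣ 𝔸 → ℂ)
    (space : (j : ℕ) → (sys j).Dom → ℝ → ℝ → Set (FieldPair P 0 𝔸ˣ 𝔸))
    (agreeOn : (j : ℕ) → (sys j).Dom → FieldPair P 0 𝔸ˣ 𝔸 → FieldPair P 0 𝔸ˣ 𝔸 → Prop)
    (logZ : ℕ → GaugeField P 0 G → ℝ) {c : SFConsts} {k : ℕ}
    (h : SFHyp (modelTower π ξ ρ flow sys E space agreeOn logZ) c k) :
    GaugeInvariant ((modelTower π ξ ρ flow sys E space agreeOn logZ).action16 k) :=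
  gaugeInvariant_action16 _ h (fun u x => ρ (u x)) (modelTower_intertwines π ξ ρ hπ flow sys E space agreeOn logZ)

end Model

end

end Literature.MathematicalPhysics.QuantumFieldTheory.Balaban1983to89.B12GaugeOrbits021
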